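import Summits.QuantumFields.YangMills.Theorems.BalabanStepParabolic.Negative.TorusGibbs

/-!
# `BalabanStepParabolic` — negative-side support VII: finite-torus regularity of the centred plaquette correlators

Part 3 of 3 (crux `stmt-QuantumFields-9684`, disprover's work file §E). Tree objects only.

* `continuous_wilsonCentredSchwinger`: for EVERY species string and normalisations, the centred unit-lattice
  Wilson `n`-point function `wilsonCentredSchwinger r.ρ β L c n σ f` is continuous in `β ∈ ℝ` (joint dominated
  convergence in `(β, centrings)`, `continuous_jointIntegral`, composed with continuity of the torus means).
* `Pmax_sub_mean_bounds` (`0 ≤ Pmax − ⟨P⟩_β ≤ 16⟨S_W⟩_β`), `abs_curvCorr_le` (`|⟨∏ centred smeared P⟩_β| ≤ K⟨S_W⟩_β`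
  for `n ≥ 1`), **`curvatureTorusRegular_holds'`**: the genuine centred plaquette `n`-point functions on a fixed
  odd torus are continuous in `β` and CONVERGE as `β → ∞` (to `1` for `n = 0`, to `0` for `n ≥ 1`).
This is exactly the hypothesis under which the EVEN-`M` half of the crux is junk-inhabited (support file
`EvenRedundant.lean`), and it discharges the necessary condition `tendsto_curvCorr_atTop` of `OrbitTransport.lean`.
-/

namespace Summit.QuantumFields.YangMills.Theorems.BalabanStepParabolic.Negative

open scoped SchwartzMap
open MeasureTheory Filter Topology
open Literature.MathematicalPhysics.QuantumFieldTheory Literature.MathematicalPhysics.AQFT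
open Literature.MathematicalPhysics.QuantumLattice
open Literature.Probability.LatticeModels (box Torus.proj Torus.proj_apply)

noncomputable section

section TorusRegularity

variable {G : Type} [Group G] [TopologicalSpace G] [IsTopologicalGroup G] [CompactSpace G]
  [MeasurableSpace G] [BorelSpace G] (r : LatticeRep G) (T : ℕ) [NeZero T]

/-! #### Continuity in `β` of the centred `n`-point functions -/

omit [TopologicalSpace G] [IsTopologicalGroup G] [CompactSpace G] [BorelSpace G] [NeZero T] in
/-- Smeared local fields of the periodic lift are measurable on torus configurations. [folklore] -/
theorem measurable_smeared_lift (O : YMSpecies G) (Λ : Finset (Fin 4 → ℤ)) (a c m : ℝ)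
    (f : 𝓢(EuclideanSpace ℝ (Fin 4), ℝ)) :
    Measurable fun U : GaugeConfig 4 T G => smearedLatticeField O.F Λ a c m f (torusLift T U) := by
  unfold smearedLatticeField
  refine Measurable.const_mul (Finset.measurable_sum _ fun x _ => ?_) _
  refine Measurable.const_mul ?_ _
  exact ((O.measurable.comp ((configShift (-x)).measurable.comp (measurable_torusLift T))).sub_const m)

omit [Group G] [TopologicalSpace G] [IsTopologicalGroup G] [CompactSpace G] [BorelSpace G] [NeZero T] in
/-- Crude bound on a smeared local field: `|Φ(f)| ≤ |c| a⁴ ∑ₓ |f(a x)| (C_O + |m|)`. [folklore] -/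
theorem abs_smeared_le {O : LGConfig 4 G → ℝ} {C : ℝ} (hO : ∀ V, |O V| ≤ C) (Λ : Finset (Fin 4 → ℤ))
    (a c m : ℝ) (f : 𝓢(EuclideanSpace ℝ (Fin 4), ℝ)) (V : LGConfig 4 G) :
    |smearedLatticeField O Λ a c m f V| ≤
      |c| * |a| ^ 4 * ∑ x ∈ Λ, |f (a • siteToE x)| * (C + |m|) := by
  unfold smearedLatticeField
  rw [abs_mul, abs_mul, abs_pow]
  refine mul_le_mul_of_nonneg_left ?_ (by positivity)
  refine (Finset.abs_sum_le_sum_abs _ _).trans (Finset.sum_le_sum fun x _ => ?_)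
  rw [abs_mul]
  refine mul_le_mul_of_nonneg_left ?_ (abs_nonneg _)
  exact (abs_sub _ _).trans (add_le_add (hO _) le_rfl)

variable (L : ℕ) {n : ℕ} (c : YMSpecies G → ℝ) (σ : Fin n → YMSpecies G)
  (f : Fin n → 𝓢(EuclideanSpace ℝ (Fin 4), ℝ))

/-- The Boltzmann-weighted product integrand, parametrised by `(β, m)`. -/
def jointIntegrand (q : ℝ × (Fin n → ℝ)) (U : GaugeConfig 4 (2 * L + 1) G) : ℝ :=
  Real.exp (-q.1 * wilsonAction r.ρ U) *
    ∏ i, smearedLatticeField (σ i).F (box 4 L) 1 (c (σ i)) (q.2 i) (f i) (torusLift (2 * L + 1) U)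

/-- **Joint continuity in `(β, m)`** of the Boltzmann-weighted Haar integral of the product of
smeared fields with free centrings `m` (dominated convergence on the compact configuration space). [folklore] -/
theorem continuous_jointIntegral :
    Continuous fun q : ℝ × (Fin n → ℝ) => ∫ U, jointIntegrand r L c σ f q U ∂(haarPi (2 * L + 1)) := by
  obtain ⟨B, hB0, hB⟩ := exists_exp_action_bounds r (2 * L + 1)
  have hCO : ∀ i, ∃ C, 0 ≤ C ∧ ∀ V, |(σ i).F V| ≤ C := fun i => by
    obtain ⟨C, hC⟩ := (σ i).bounded
    exact ⟨max C 0, le_max_right _ _, fun V => (hC V).trans (le_max_left _ _)⟩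
  choose C hC0 hC using hCO
  refine continuous_iff_continuousAt.2 fun q₀ => ?_
  -- the dominating constant on the unit ball around q₀
  set K : ℝ := Real.exp ((‖q₀‖ + 1) * B) *
    ∏ i, (|c (σ i)| * |(1 : ℝ)| ^ 4 *
      ∑ x ∈ box 4 L, |f i ((1 : ℝ) • siteToE x)| * (C i + (‖q₀‖ + 1)))
  refine continuousAt_of_dominated (bound := fun _ => K) ?_ ?_ (integrable_const _) ?_
  · refine Eventually.of_forall fun q => ?_
    refine ((measurable_expAction r (2 * L + 1) q.1).mul ?_).aestronglyMeasurable
    exact Finset.measurable_prod _ fun i _ => measurable_smeared_lift (2 * L + 1) (σ i) _ _ _ _ _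
  · filter_upwards [Metric.ball_mem_nhds q₀ one_pos] with q hq
    refine ae_of_all _ fun U => ?_
    have hqn : ‖q‖ ≤ ‖q₀‖ + 1 := by
      have h1 := Metric.mem_ball.1 hq
      rw [dist_eq_norm] at h1
      have := norm_le_norm_add_norm_sub' q q₀
      have := norm_sub_rev q q₀
      linarith [norm_le_insert' q q₀]
    unfold jointIntegrand
    rw [Real.norm_eq_abs, abs_mul, abs_of_pos (Real.exp_pos _), Finset.abs_prod]
    refine mul_le_mul ?_ ?_ (Finset.prod_nonneg fun i _ => abs_nonneg _) (Real.exp_pos _).le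
    · have hq1 : |q.1| ≤ ‖q₀‖ + 1 := (norm_fst_le q).trans hqn
      exact (hB q.1 U).2.trans (Real.exp_le_exp.2 (mul_le_mul_of_nonneg_right hq1 hB0))
    · refine Finset.prod_le_prod (fun i _ => abs_nonneg _) fun i _ => ?_
      refine (abs_smeared_le (hC i) _ _ _ _ _ _).trans ?_
      have hq2 : |q.2 i| ≤ ‖q₀‖ + 1 := by
        have := norm_le_pi_norm q.2 i
        have := norm_snd_le q
        rw [Real.norm_eq_abs] at *
        linarith
      gcongr
  · refine ae_of_all _ fun U => ?_
    unfold jointIntegrand smearedLatticeField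
    refine Continuous.continuousAt ?_
    refine Continuous.mul (by fun_prop) ?_
    exact continuous_finsetProd _ fun i _ => by fun_prop

/-- The torus Wilson mean of a species is continuous in `β`. [folklore] -/
theorem continuous_wilsonTorusMean (O : YMSpecies G) :
    Continuous fun β => wilsonTorusMean r.ρ β L O.F := by
  obtain ⟨C, hC⟩ := O.bounded
  exact continuous_integral_wilsonMeasure r (2 * L + 1) (fun U => O.F (torusLift (2 * L + 1) U))
    (O.measurable.comp (measurable_torusLift _)) (C := C) fun U => hC _

/-- The centred Wilson `n`-point function in Gibbs form. [folklore] -/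
theorem wilsonCentredSchwinger_eq_joint (β : ℝ) :
    wilsonCentredSchwinger r.ρ β L c n σ f =
      (Zr r (2 * L + 1) β)⁻¹ * ∫ U, jointIntegrand r L c σ f
        (β, fun i => wilsonTorusMean r.ρ β L (σ i).F) U ∂(haarPi (2 * L + 1)) := by
  unfold wilsonCentredSchwinger jointIntegrand
  rw [integral_wilsonMeasure_eq r (2 * L + 1)]

/-- **Continuity in `β ∈ ℝ` of the centred unit-lattice Wilson `n`-point functions** on a fixed
torus (any species string, any normalisations). [folklore] -/
theorem continuous_wilsonCentredSchwinger :
    Continuous fun β => wilsonCentredSchwinger r.ρ β L c n σ f := by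
  have heq : (fun β => wilsonCentredSchwinger r.ρ β L c n σ f) = fun β =>
      (Zr r (2 * L + 1) β)⁻¹ * ∫ U, jointIntegrand r L c σ f
        (β, fun i => wilsonTorusMean r.ρ β L (σ i).F) U ∂(haarPi (2 * L + 1)) :=
    funext (wilsonCentredSchwinger_eq_joint r L c σ f)
  rw [heq]
  refine ((continuous_Zr r (2 * L + 1)).inv₀ fun β => (Zr_pos r (2 * L + 1) β).ne').mul ?_
  refine (continuous_jointIntegral r L c σ f).comp ?_
  exact continuous_id.prodMk (continuous_pi fun i => continuous_wilsonTorusMean r L (σ i))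

/-! #### The `β → ∞` limit of the centred plaquette `n`-point functions is `0` (`n ≥ 1`) -/

/-- `∑ₓ |g(x)|` over the box: the `ℓ¹` size of a unit-scale test function. -/
def l1Box (g : 𝓢(EuclideanSpace ℝ (Fin 4), ℝ)) : ℝ :=
  ∑ x ∈ box 4 L, |g (siteToE x)|

omit [Group G] [TopologicalSpace G] [IsTopologicalGroup G] [CompactSpace G] [MeasurableSpace G]
  [BorelSpace G] in
/-- `l1Box` is non-negative. [folklore] -/
theorem l1Box_nonneg (g : 𝓢(EuclideanSpace ℝ (Fin 4), ℝ)) : 0 ≤ l1Box L g :=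
  Finset.sum_nonneg fun _ _ => abs_nonneg _

/-- The plaquette species of `r` is the action density. [folklore] -/
theorem curvature_F : r.curvature.F = actionDensity r.ρ := rfl

/-- Integrability of bounded measurable observables under the torus Wilson state. [folklore] -/
theorem integrable_wilson_of_bound (β : ℝ) {F : GaugeConfig 4 (2 * L + 1) G → ℝ} (hFm : Measurable F)
    {C : ℝ} (hC : ∀ U, |F U| ≤ C) :
    Integrable F (wilsonMeasure (d := 4) (L := 2 * L + 1) r.ρ β) := by
  haveI := isProbabilityMeasure_wilsonMeasure (d := 4) (L := 2 * L + 1) r.ρ r.continuous β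
  exact Integrable.of_bound hFm.aestronglyMeasurable C (ae_of_all _ fun U => by
    rw [Real.norm_eq_abs]; exact hC U)

/-- **The mean plaquette deficit is controlled by `⟨S_W⟩_β`:**
`0 ≤ Pmax − ⟨P⟩_β ≤ 16 ⟨S_W⟩_β`. [folklore] -/
theorem Pmax_sub_mean_bounds (β : ℝ) :
    0 ≤ Pmax r - wilsonTorusMean r.ρ β L (actionDensity r.ρ) ∧
      Pmax r - wilsonTorusMean r.ρ β L (actionDensity r.ρ) ≤
        16 * ∫ U, wilsonAction r.ρ U ∂(wilsonMeasure (d := 4) (L := 2 * L + 1) r.ρ β) := by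
  haveI := isProbabilityMeasure_wilsonMeasure (d := 4) (L := 2 * L + 1) r.ρ r.continuous β
  haveI := secondCountable_of_latticeRep r
  obtain ⟨C, hC⟩ := r.curvature.bounded
  have hPm : Measurable fun U : GaugeConfig 4 (2 * L + 1) G => actionDensity r.ρ (torusLift (2 * L + 1) U) :=
    (curvature_F r ▸ r.curvature.measurable).comp (measurable_torusLift _)
  have hPint : Integrable (fun U : GaugeConfig 4 (2 * L + 1) G => actionDensity r.ρ (torusLift (2 * L + 1) U))
      (wilsonMeasure (d := 4) (L := 2 * L + 1) r.ρ β) :=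
    integrable_wilson_of_bound r L β hPm (C := C) fun U => by rw [← curvature_F]; exact hC _
  obtain ⟨B, hB⟩ := exists_abs_wilsonAction_le (d := 4) (L := 2 * L + 1) r.ρ r.continuous
  have hSint : Integrable (wilsonAction (d := 4) (L := 2 * L + 1) (G := G) r.ρ)
      (wilsonMeasure (d := 4) (L := 2 * L + 1) r.ρ β) :=
    integrable_wilson_of_bound r L β (measurable_wilsonAction r.ρ r.continuous) hB
  have heq : Pmax r - wilsonTorusMean r.ρ β L (actionDensity r.ρ) =
      ∫ U, (Pmax r - actionDensity r.ρ (torusLift (2 * L + 1) U))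
        ∂(wilsonMeasure (d := 4) (L := 2 * L + 1) r.ρ β) := by
    rw [integral_sub (integrable_const _) hPint, integral_const, probReal_univ, one_smul]
    rfl
  rw [heq]
  constructor
  · exact integral_nonneg fun U => sub_nonneg.2 (actionDensity_lift_le_Pmax r _ U)
  · rw [← integral_const_mul]
    refine integral_mono ((integrable_const _).sub hPint) (hSint.const_mul _) fun U => ?_
    have h := Pmax_sub_actionDensity_le r (T := 2 * L + 1) U 0
    rwa [neg_zero, configShift_zero'] at h

/-- **Domination of the centred plaquette `(k+1)`-point function by `⟨S_W⟩_β`**: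
`|curvCorr β| ≤ K_c ⟨S_W⟩_β` with `K_c` independent of `β`. [folklore] -/
theorem abs_curvCorr_le (k : ℕ) (f : Fin (k + 1) → 𝓢(EuclideanSpace ℝ (Fin 4), ℝ)) :
    ∃ Kc : ℝ, ∀ β : ℝ, |wilsonCentredSchwinger r.ρ β L (fun _ => 1) (k + 1) (fun _ => r.curvature) f| ≤
      Kc * ∫ U, wilsonAction r.ρ U ∂(wilsonMeasure (d := 4) (L := 2 * L + 1) r.ρ β) := by
  haveI := secondCountable_of_latticeRep r
  obtain ⟨C, hC⟩ := r.curvature.bounded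
  set CP := max C 0 with hCPdef
  have hCP0 : 0 ≤ CP := le_max_right _ _
  have hCP : ∀ V, |actionDensity r.ρ V| ≤ CP := fun V => by
    rw [← curvature_F]; exact (hC V).trans (le_max_left _ _)
  set Kp : ℝ := ∏ i : Fin k, (l1Box L (f i.succ) * (2 * CP)) with hKpdef
  have hKp0 : 0 ≤ Kp := Finset.prod_nonneg fun i _ => mul_nonneg (l1Box_nonneg L _) (by positivity)
  refine ⟨32 * l1Box L (f 0) * Kp, fun β => ?_⟩
  haveI := isProbabilityMeasure_wilsonMeasure (d := 4) (L := 2 * L + 1) r.ρ r.continuous β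
  set μ := wilsonMeasure (d := 4) (L := 2 * L + 1) r.ρ β with hμ
  set m := wilsonTorusMean r.ρ β L (actionDensity r.ρ) with hmdef
  set D := Pmax r - m with hDdef
  set ES := ∫ U, wilsonAction r.ρ U ∂μ with hES
  obtain ⟨hD0, hD⟩ := Pmax_sub_mean_bounds r L β
  rw [← hmdef, ← hDdef] at hD0 hD
  -- |m| ≤ CP
  have hm : |m| ≤ CP := by
    rw [hmdef, wilsonTorusMean]
    refine (abs_integral_le_integral_abs).trans ?_
    have hint : Integrable (fun U : GaugeConfig 4 (2 * L + 1) G => |actionDensity r.ρ (torusLift (2 * L + 1) U)|) μ :=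
      (integrable_wilson_of_bound r L β ((curvature_F r ▸ r.curvature.measurable).comp
        (measurable_torusLift _)) (fun U => hCP _)).abs
    refine (integral_mono hint (integrable_const CP) fun U => hCP _).trans ?_
    rw [integral_const, probReal_univ, one_smul]
  -- the factors
  set A : Fin (k + 1) → GaugeConfig 4 (2 * L + 1) G → ℝ := fun i U =>
    smearedLatticeField (actionDensity r.ρ) (box 4 L) 1 1 m (f i) (torusLift (2 * L + 1) U) with hA
  have hcurv : wilsonCentredSchwinger r.ρ β L (fun _ => 1) (k + 1) (fun _ => r.curvature) f =
      ∫ U, ∏ i, A i U ∂μ := rfl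
  have hS0 : ∀ U : GaugeConfig 4 (2 * L + 1) G, 0 ≤ wilsonAction r.ρ U := wilsonAction_nonneg' r
  -- bounds on the factors
  have hA_succ : ∀ (i : Fin k) (U : GaugeConfig 4 (2 * L + 1) G),
      |A i.succ U| ≤ l1Box L (f i.succ) * (2 * CP) := by
    intro i U
    refine (abs_smeared_le hCP _ _ _ _ _ _).trans ?_
    simp only [abs_one, one_pow, one_mul, one_smul, l1Box, Finset.sum_mul]
    refine Finset.sum_le_sum fun x _ => ?_
    have : CP + |m| ≤ 2 * CP := by linarith
    exact mul_le_mul_of_nonneg_left this (abs_nonneg _)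
  have hA_zero : ∀ U : GaugeConfig 4 (2 * L + 1) G,
      |A 0 U| ≤ l1Box L (f 0) * (16 * wilsonAction r.ρ U + D) := by
    intro U
    simp only [hA, smearedLatticeField, one_pow, one_mul, one_smul, l1Box, Finset.sum_mul]
    refine (Finset.abs_sum_le_sum_abs _ _).trans (Finset.sum_le_sum fun x _ => ?_)
    rw [abs_mul]
    refine mul_le_mul_of_nonneg_left ?_ (abs_nonneg _)
    have h1 := Pmax_sub_actionDensity_nonneg r (2 * L + 1) U x
    have h2 := Pmax_sub_actionDensity_le r (T := 2 * L + 1) U x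
    have : |actionDensity r.ρ (configShift (-x) (torusLift (2 * L + 1) U)) - m| ≤
        (Pmax r - actionDensity r.ρ (configShift (-x) (torusLift (2 * L + 1) U))) + D := by
      rw [abs_le]; constructor <;> linarith
    linarith
  -- pointwise bound on the product
  have hprod : ∀ U : GaugeConfig 4 (2 * L + 1) G,
      |∏ i, A i U| ≤ Kp * l1Box L (f 0) * (16 * wilsonAction r.ρ U + D) := by
    intro U
    rw [Finset.abs_prod, Fin.prod_univ_succ]
    have hrest : ∏ i : Fin k, |A i.succ U| ≤ Kp :=
      Finset.prod_le_prod (fun i _ => abs_nonneg _) fun i _ => hA_succ i U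
    have hrest0 : 0 ≤ ∏ i : Fin k, |A i.succ U| := Finset.prod_nonneg fun i _ => abs_nonneg _
    have hz := hA_zero U
    have hpos : 0 ≤ l1Box L (f 0) * (16 * wilsonAction r.ρ U + D) :=
      mul_nonneg (l1Box_nonneg L _) (by nlinarith [hS0 U])
    calc |A 0 U| * ∏ i : Fin k, |A i.succ U|
        ≤ (l1Box L (f 0) * (16 * wilsonAction r.ρ U + D)) * Kp :=
          mul_le_mul hz hrest hrest0 hpos
      _ = Kp * l1Box L (f 0) * (16 * wilsonAction r.ρ U + D) := by ring
  -- integrability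
  obtain ⟨B, hB⟩ := exists_abs_wilsonAction_le (d := 4) (L := 2 * L + 1) r.ρ r.continuous
  have hSint : Integrable (wilsonAction (d := 4) (L := 2 * L + 1) (G := G) r.ρ) μ :=
    integrable_wilson_of_bound r L β (measurable_wilsonAction r.ρ r.continuous) hB
  have hRint : Integrable (fun U : GaugeConfig 4 (2 * L + 1) G =>
      Kp * l1Box L (f 0) * (16 * wilsonAction r.ρ U + D)) μ :=
    ((hSint.const_mul 16).add (integrable_const D)).const_mul _
  have hPm : Measurable fun U : GaugeConfig 4 (2 * L + 1) G => ∏ i, A i U :=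
    Finset.measurable_prod _ fun i _ => measurable_smeared_lift (2 * L + 1) r.curvature _ _ _ _ _
  have hPint : Integrable (fun U : GaugeConfig 4 (2 * L + 1) G => |∏ i, A i U|) μ := by
    refine (Integrable.of_bound hPm.aestronglyMeasurable (Kp * l1Box L (f 0) * (16 * B + D))
      (ae_of_all _ fun U => ?_)).abs
    rw [Real.norm_eq_abs]
    refine (hprod U).trans ?_
    have hSB : wilsonAction r.ρ U ≤ B := (le_abs_self _).trans (hB U)
    have := mul_nonneg hKp0 (l1Box_nonneg L (f 0))
    nlinarith
  -- integrate
  calc |wilsonCentredSchwinger r.ρ β L (fun _ => 1) (k + 1) (fun _ => r.curvature) f|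
        = |∫ U, ∏ i, A i U ∂μ| := by rw [hcurv]
    _ ≤ ∫ U, |∏ i, A i U| ∂μ := abs_integral_le_integral_abs
    _ ≤ ∫ U, Kp * l1Box L (f 0) * (16 * wilsonAction r.ρ U + D) ∂μ := integral_mono hPint hRint hprod
    _ = Kp * l1Box L (f 0) * (16 * ES + D) := by
        rw [integral_const_mul, integral_add (hSint.const_mul 16) (integrable_const D),
          integral_const_mul, integral_const, probReal_univ, one_smul]
    _ ≤ Kp * l1Box L (f 0) * (16 * ES + 16 * ES) := by
        have := mul_nonneg hKp0 (l1Box_nonneg L (f 0))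
        nlinarith
    _ = 32 * l1Box L (f 0) * Kp * ES := by ring

/-- **Finite-torus regularity holds** : the
genuine centred plaquette `n`-point functions on a fixed odd torus are continuous in `β` and
converge as `β → ∞` (to `1` for `n = 0`, to `0` for `n ≥ 1`). [folklore] -/
theorem curvatureTorusRegular_holds' :
    ∀ (n : ℕ) (f : Fin n → 𝓢(EuclideanSpace ℝ (Fin 4), ℝ)),
      Continuous (fun β => wilsonCentredSchwinger r.ρ β L (fun _ => 1) n (fun _ => r.curvature) f) ∧
        ∃ ℓ : ℝ, Tendsto (fun β => wilsonCentredSchwinger r.ρ β L (fun _ => 1) n (fun _ => r.curvature) f)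
          atTop (𝓝 ℓ) := by
  intro n f
  refine ⟨continuous_wilsonCentredSchwinger r L _ _ f, ?_⟩
  cases n with
  | zero =>
    refine ⟨1, tendsto_const_nhds.congr fun β => ?_⟩
    haveI := isProbabilityMeasure_wilsonMeasure (d := 4) (L := 2 * L + 1) r.ρ r.continuous β
    rw [wilsonCentredSchwinger_zero]
    exact (probReal_univ).symm
  | succ k =>
    obtain ⟨Kc, hKc⟩ := abs_curvCorr_le r L k f
    refine ⟨0, ?_⟩
    have h := (tendsto_expect_wilsonAction r (2 * L + 1)).const_mul Kc
    rw [mul_zero] at h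
    exact squeeze_zero_norm (fun β => by rw [Real.norm_eq_abs]; exact hKc β) h

end TorusRegularity

end

end Summit.QuantumFields.YangMills.Theorems.BalabanStepParabolic.Negative
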